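import Literature.NumberTheory.EllipticCurves.CMTorsionGaloisImageProofs
import HarnessLib

/-!
# The twisting character of a given `√D ∈ End_{K̄}(E)`, and the rank-two rigidity of `End_{K̄}(E)`

Topic `NumberTheory/EllipticCurves`; theorems only (no definitions, no named facts), a sibling
of `CMTorsionGaloisImageProofs.lean` serving the discharge of
`Literature.NumberTheory.EllipticCurves.cmTorsion_cartanImage` (Lang, *Elliptic Functions*,
Ch. 10 §4).  There the twisting character `χ` of Lang's Remark ("all elements of `End(A)` are
defined over `K ⊇ k`; `θ(μ)^σ = θ(μ^σ)`") was built for the particular `ψ = 2φ₀ − t` of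
`exists_sq_eq_intCast_of_hasCM`; the discharge needs it for an ARBITRARY `ψ ∈ End_{ℚ̄}(E)` with
`ψ² = D < 0` (the `√D` transported from a reference curve), together with two rigidity
statements for the commutative rank-two domain `End_{K̄}(E)` (Silverman, *AEC*, Cor. III.9.4:
`End(E)` is `ℤ` or an order in an imaginary quadratic field):

* `exists_intCast_mul_eq_of_mem_geomEndRing` — **rank two**: if `ψ ∈ End_{K̄}(E)`, `ψ² = D < 0`,
  then every `c ∈ End_{K̄}(E)` satisfies `N c = a + bψ` for some integers `N ≠ 0`, `a`, `b`
  (from the integral quadratic relations of `c` and `c + ψ`, the tree's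
  `WeierstrassCurve.exists_int_quadratic_of_mem_geomEndRing`, Lang Ch. 13 §2 / *AEC* III.9, and
  commutativity `WeierstrassCurve.geomEndRing_comm_holds`, *AEC* III.5.6(c)):
  `(2ψ + s)c = t'ψ + r` with `s, r ∈ ℤ`, multiplied by `s − 2ψ`, `N = s² − 4D > 0`.
* `apply_smul_eq_smul_apply_of_mem_geomEndRing` — **an automorphism fixing `√D` fixes all of
  `End_{K̄}(E)`**: if `σ ∈ Γ_K` commutes with `ψ` then it commutes with every `c ∈ End_{K̄}(E)`
  (`N·(σcσ⁻¹ − c) = 0` in the characteristic-`0` domain `End_{K̄}(E)`,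
  `WeierstrassCurve.isDomain_geomEndRing`, `WeierstrassCurve.charZero_geomEndRing`; this is
  Lang's Remark read backwards: `End(A)` is defined over `k(j) = ℚ(√D, j)`).
* `exists_quadraticTwist_of_sq_eq_intCast` — **Lang's Remark for a given `ψ`** over `ℚ`: a
  non-trivial `χ : Γ_ℚ →* ℤˣ` with `ψ(σP) = χ(σ)·σψ(P)` (verbatim the argument of
  `WeierstrassCurve.exists_sq_eq_intCast_quadraticTwist_of_hasCM`).
* `exists_restrict_geomTorsion_of_twist` — restriction of such a `ψ` to every torsion level
  `E[n]` with `φ² = D` and the twist (verbatim the argument of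
  `WeierstrassCurve.exists_sqrt_twist_geomTorsion_of_hasCM`), for any base field.
* `coe_pow_apply_geomTorsion`, `pow_smul_eq_pow_apply` — bookkeeping: powers of an endomorphism
  of `E[n]` versus powers of a lift to `E(K̄)`, and `σᵏ` acting as `Tᵏ` when `σ` acts as `T`.

## References

* S. Lang, *Elliptic Functions*, 2nd ed., GTM 112 (1987), Ch. 10 §4, Remark; Ch. 13 §2.
  [Lang1987]
* J. H. Silverman, *The Arithmetic of Elliptic Curves*, 2nd ed. (2009), Cor. III.5.6(c),
  Cor. III.6.3, Cor. III.9.4. [SilvermanAEC2009]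
* J. H. Silverman, *Advanced Topics in the Arithmetic of Elliptic Curves* (1994), Thm. II.2.2.
  [SilvermanAdvancedTopics1994]
-/

noncomputable section

open scoped Classical

namespace Literature.NumberTheory.EllipticCurves

-- `_root_`: some import closures declare `Literature.NumberTheory.EllipticCurves.WeierstrassCurve.*`
open _root_.WeierstrassCurve
open Field (absoluteGaloisGroup)

universe u

section AnyField

variable {K : Type u} [Field K] (W : WeierstrassCurve K)

/-! ## Bookkeeping on torsion levels -/

/-- Powers of an endomorphism `T` of `E[n]` agree with powers of any lift `T'` of `T` to `E(K̄)`.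
[folklore] -/
theorem coe_pow_apply_geomTorsion {n : ℤ} {T : AddMonoid.End (W.geomTorsion n)}
    {T' : AddMonoid.End W.geomPoints}
    (h : ∀ Q : W.geomTorsion n, ((T Q : W.geomTorsion n) : W.geomPoints) = T' Q) (k : ℕ)
    (Q : W.geomTorsion n) :
    (((T ^ k) Q : W.geomTorsion n) : W.geomPoints) = (T' ^ k) (Q : W.geomPoints) := by
  induction k with
  | zero => simp only [pow_zero, AddMonoid.End.coe_one, id_eq]
  | succ k ih => simp only [pow_succ', AddMonoid.End.coe_mul, Function.comp_apply, h, ih]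

/-- If `σ` acts on `E[n]` as the endomorphism `T`, then `σᵏ` acts as `Tᵏ`. [folklore] -/
theorem pow_smul_eq_pow_apply {n : ℤ} {T : AddMonoid.End (W.geomTorsion n)}
    {σ : absoluteGaloisGroup K} (h : ∀ Q : W.geomTorsion n, σ • Q = T Q) (k : ℕ)
    (Q : W.geomTorsion n) : σ ^ k • Q = (T ^ k) Q := by
  induction k with
  | zero => simp only [pow_zero, one_smul, AddMonoid.End.coe_one, id_eq]
  | succ k ih => rw [pow_succ', mul_smul, ih, h, pow_succ', AddMonoid.End.coe_mul,
      Function.comp_apply]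

/-- **Restriction of a twisted `√D` to the torsion.**  If `ψ ∈ AddMonoid.End E(K̄)` satisfies
`ψ ∘ ψ = D` and `ψ(σ • P) = χ(σ) • σ • ψ(P)` for a character `χ : Γ_K →* ℤˣ`, then for every `n`
its restriction `φ` to `E[n]` (an additive map preserves `E[n]`) satisfies `φ ∘ φ = D` and the same
twist — conjuncts (1), (5) of `cmTorsion_cartanImage` at level `n` (the argument of
`WeierstrassCurve.exists_sqrt_twist_geomTorsion_of_hasCM`, for a given `ψ`).
[cite: Lang1987, Ch. 10 §4, Remark] -/
theorem exists_restrict_geomTorsion_of_twist {ψ : AddMonoid.End W.geomPoints} {D : ℤ}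
    (hψψ : ψ * ψ = (D : AddMonoid.End W.geomPoints)) {χ : absoluteGaloisGroup K →* ℤˣ}
    (hrel : ∀ (σ : absoluteGaloisGroup K) (P : W.geomPoints),
      ψ (σ • P) = ((χ σ : ℤˣ) : ℤ) • σ • ψ P) (n : ℤ) :
    ∃ φ : AddMonoid.End (W.geomTorsion n),
      (∀ P : W.geomTorsion n, ((φ P : W.geomTorsion n) : W.geomPoints) = ψ P) ∧
      (∀ P : W.geomTorsion n, φ (φ P) = D • P) ∧
      (∀ (σ : absoluteGaloisGroup K) (P : W.geomTorsion n),
        φ (σ • P) = ((χ σ : ℤˣ) : ℤ) • σ • φ P) := by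
  have hψψP : ∀ P : W.geomPoints, ψ (ψ P) = D • P := fun P ↦ by
    have := congrArg (fun f : AddMonoid.End W.geomPoints ↦ f P) hψψ
    simpa only [AddMonoid.End.coe_mul, Function.comp_apply, AddMonoid.End.intCast_apply] using this
  have hmem : ∀ P : W.geomTorsion n, ψ (P : W.geomPoints) ∈ W.geomTorsion n := fun P ↦ by
    have hP := P.2
    rw [Submodule.mem_toAddSubgroup, Submodule.mem_torsionBy_iff] at hP ⊢
    rw [← map_zsmul, hP, map_zero]
  let φ : AddMonoid.End (W.geomTorsion n) :=
    ((ψ : W.geomPoints →+ W.geomPoints).restrict (W.geomTorsion n)).codRestrict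
      (W.geomTorsion n) hmem
  have hφ : ∀ P : W.geomTorsion n, ((φ P : W.geomTorsion n) : W.geomPoints) = ψ P := fun P ↦ rfl
  refine ⟨φ, hφ, fun P ↦ Subtype.ext ?_, fun σ P ↦ Subtype.ext ?_⟩
  · rw [hφ, hφ, hψψP]; rfl
  · rw [hφ, AddSubgroup.torsionBy.coe_smul, hrel]; rfl

/-! ## Rank two: `N · End_{K̄}(E) ⊆ ℤ + ℤ√D` -/

variable [CharZero K] [W.IsElliptic]

/-- **`End_{K̄}(E)` has rank two over `ℤ[√D]`-multiples.**  Let `E/K` be an elliptic curve over a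
field of characteristic `0`, `ψ ∈ End_{K̄}(E)` with `ψ² = D < 0`.  Then for every
`c ∈ End_{K̄}(E)` there are integers `N ≠ 0`, `a`, `b` with `N c = a + bψ`.  Proof: `c` and
`c + ψ` satisfy integral quadratic equations `c² − tc + d = 0`, `(c + ψ)² − t'(c + ψ) + d' = 0`
(`WeierstrassCurve.exists_int_quadratic_of_mem_geomEndRing`), and `End_{K̄}(E)` is commutative
(`WeierstrassCurve.geomEndRing_comm_holds`); subtracting, `(2ψ + s)c = t'ψ + r` with `s = t − t'`,
`r = d − D − d'`, and multiplying by `s − 2ψ` gives `(s² − 4D)c ∈ ℤ + ℤψ` with `s² − 4D > 0`.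
(Silverman, *AEC*, Cor. III.9.4: `End(E) ⊗ ℚ` is `ℚ` or the imaginary quadratic field `ℚ(√D)`.)
[cite: SilvermanAEC2009, Cor. III.9.4] -/
theorem exists_intCast_mul_eq_of_mem_geomEndRing {ψ : AddMonoid.End W.geomPoints}
    (hψ : ψ ∈ W.geomEndRing) {D : ℤ} (hD : D < 0)
    (hψψ : ψ * ψ = (D : AddMonoid.End W.geomPoints)) {c : AddMonoid.End W.geomPoints}
    (hc : c ∈ W.geomEndRing) :
    ∃ N a b : ℤ, N ≠ 0 ∧ (N : AddMonoid.End W.geomPoints) * c =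
      (a : AddMonoid.End W.geomPoints) + (b : AddMonoid.End W.geomPoints) * ψ := by
  obtain ⟨t, d, hcd, -⟩ := W.exists_int_quadratic_of_mem_geomEndRing hc
  obtain ⟨t', d', hcd', -⟩ :=
    W.exists_int_quadratic_of_mem_geomEndRing (W.geomEndRing.add_mem hc hψ)
  -- work in the commutative ring `R = End_{K̄}(E)`
  letI : CommRing W.geomEndRing :=
    { (inferInstance : Ring W.geomEndRing) with
      mul_comm := fun x y ↦ Subtype.ext (W.geomEndRing_comm_holds _ _ x.2 y.2) }
  set x : W.geomEndRing := ⟨c, hc⟩ with hx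
  set y : W.geomEndRing := ⟨ψ, hψ⟩ with hy
  have h1 : x * x - (t : W.geomEndRing) * x + (d : W.geomEndRing) = 0 :=
    Subtype.ext (by push_cast; exact hcd)
  have h2 : (x + y) * (x + y) - (t' : W.geomEndRing) * (x + y) + (d' : W.geomEndRing) = 0 :=
    Subtype.ext (by push_cast; exact hcd')
  have h3 : y * y = (D : W.geomEndRing) := Subtype.ext (by push_cast; exact hψψ)
  set N : ℤ := (t - t') ^ 2 - 4 * D with hN
  set a : ℤ := (t - t') * (d - D - d') - 2 * t' * D with ha
  set b : ℤ := (t - t') * t' - 2 * (d - D - d') with hb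
  have hN0 : 0 < N := by rw [hN]; nlinarith [sq_nonneg (t - t')]
  refine ⟨N, a, b, hN0.ne', ?_⟩
  have key : (N : W.geomEndRing) * x = (a : W.geomEndRing) + (b : W.geomEndRing) * y := by
    rw [hN, ha, hb]
    push_cast
    linear_combination ((t : W.geomEndRing) - t' - 2 * y) * h2
      - ((t : W.geomEndRing) - t' - 2 * y) * h1
      - ((t : W.geomEndRing) - t' + 2 * t' - 2 * y - 4 * x) * h3
  have := congrArg Subtype.val key
  push_cast at this
  exact this

/-- **An automorphism fixing `√D` fixes `End_{K̄}(E)` pointwise.**  Let `E/K` (characteristic `0`)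
be elliptic, `ψ ∈ End_{K̄}(E)` with `ψ² = D < 0`, and `σ ∈ Γ_K` with `ψ(σ • P) = σ • ψ(P)` for all
`P`.  Then every `c ∈ End_{K̄}(E)` commutes with `σ`: `c(σ • P) = σ • c(P)`.  Indeed
`σcσ⁻¹ ∈ End_{K̄}(E)` (`WeierstrassCurve.conj_mem_geomEndRing`) and `Nc = a + bψ`
(`exists_intCast_mul_eq_of_mem_geomEndRing`) is fixed by conjugation, so `N(σcσ⁻¹ − c) = 0` in
the characteristic-`0` domain `End_{K̄}(E)` (`WeierstrassCurve.isDomain_geomEndRing`,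
`WeierstrassCurve.charZero_geomEndRing`).  This is Lang's Remark, Ch. 10 §4 ("all elements of
`End(A)` are defined over `K`" for `K ⊇ k = ℚ(√D)`) = Silverman, *AT*, Thm. II.2.2(b).
[cite: Lang1987, Ch. 10 §4, Remark] -/
theorem apply_smul_eq_smul_apply_of_mem_geomEndRing {ψ : AddMonoid.End W.geomPoints}
    (hψ : ψ ∈ W.geomEndRing) {D : ℤ} (hD : D < 0)
    (hψψ : ψ * ψ = (D : AddMonoid.End W.geomPoints)) {σ : absoluteGaloisGroup K}
    (hσ : ∀ P : W.geomPoints, ψ (σ • P) = σ • ψ P) {c : AddMonoid.End W.geomPoints}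
    (hc : c ∈ W.geomEndRing) (P : W.geomPoints) : c (σ • P) = σ • c P := by
  haveI := isDomain_geomEndRing W
  haveI := charZero_geomEndRing W
  obtain ⟨N, a, b, hN, hNc⟩ := exists_intCast_mul_eq_of_mem_geomEndRing W hψ hD hψψ hc
  set g : absoluteGaloisGroup K →* AddMonoid.End W.geomPoints :=
    DistribMulAction.toAddMonoidEnd (absoluteGaloisGroup K) W.geomPoints with hg
  have hconjP : ∀ (φ : AddMonoid.End W.geomPoints) (Q : W.geomPoints),
      (g σ * φ * g σ⁻¹) Q = σ • φ (σ⁻¹ • Q) := fun φ Q ↦ rfl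
  have hmem : g σ * c * g σ⁻¹ ∈ W.geomEndRing := conj_mem_geomEndRing W hc σ
  -- `ψ` is fixed by conjugation, hence so is `N c = a + b ψ`
  have hψfix : ∀ Q : W.geomPoints, σ • ψ (σ⁻¹ • Q) = ψ Q := fun Q ↦ by
    rw [← hσ, smul_inv_smul]
  have hgg : g σ * g σ⁻¹ = 1 := by rw [← map_mul, mul_inv_cancel, map_one]
  have hψconj : g σ * ψ * g σ⁻¹ = ψ := by
    refine AddMonoidHom.ext fun Q ↦ ?_
    change (g σ * ψ * g σ⁻¹) Q = ψ Q
    rw [hconjP, hψfix]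
  have hNconj : (N : AddMonoid.End W.geomPoints) * (g σ * c * g σ⁻¹) =
      (N : AddMonoid.End W.geomPoints) * c := by
    calc (N : AddMonoid.End W.geomPoints) * (g σ * c * g σ⁻¹)
        = g σ * ((N : AddMonoid.End W.geomPoints) * c) * g σ⁻¹ := by
          rw [← mul_assoc, ← mul_assoc, (Int.cast_commute N (g σ)).eq, mul_assoc (g σ)]
      _ = g σ * ((a : AddMonoid.End W.geomPoints) + (b : AddMonoid.End W.geomPoints) * ψ) *
            g σ⁻¹ := by rw [hNc]
      _ = (a : AddMonoid.End W.geomPoints) * (g σ * g σ⁻¹) +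
            (b : AddMonoid.End W.geomPoints) * (g σ * ψ * g σ⁻¹) := by
          rw [mul_add, add_mul, ← mul_assoc (g σ) (b : AddMonoid.End W.geomPoints) ψ,
            ← (Int.cast_commute a (g σ)).eq, ← (Int.cast_commute b (g σ)).eq]
          simp only [mul_assoc]
      _ = (N : AddMonoid.End W.geomPoints) * c := by rw [hgg, mul_one, hψconj, hNc]
  have hsub : ((N : W.geomEndRing)) * (⟨g σ * c * g σ⁻¹, hmem⟩ - ⟨c, hc⟩) = 0 := by
    rw [mul_sub, sub_eq_zero]
    exact Subtype.ext (by push_cast; exact hNconj)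
  rcases mul_eq_zero.mp hsub with h0 | h0
  · exact absurd (Int.cast_eq_zero.mp h0) hN
  · have hcc : g σ * c * g σ⁻¹ = c := congrArg Subtype.val (sub_eq_zero.mp h0)
    have := congrArg (fun f : AddMonoid.End W.geomPoints ↦ f (σ • P)) hcc
    simp only [hconjP, inv_smul_smul] at this
    exact this.symm

end AnyField

/-! ## Lang's Remark over `ℚ` for a given `√D` -/

/-- **The quadratic character twisting a given `√D` on a curve over `ℚ`.**  For an elliptic curve
`W/ℚ`, `ψ ∈ End_{ℚ̄}(W)` and `D < 0` with `ψ ∘ ψ = [D]`, there is a non-trivial homomorphism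
`χ : Γ_ℚ → ℤˣ = {±1}` with `ψ(σ • P) = χ(σ) • σ • ψ(P)` for all `σ ∈ Γ_ℚ`, `P ∈ W(ℚ̄)`:
`σψσ⁻¹ ∈ End_{ℚ̄}(W)` squares to `D`, and `x² = ψ²` forces `x = ±ψ` in the commutative domain
`End_{ℚ̄}(W)`; the sign is multiplicative in `σ`, and not identically `1` since no curve over `ℚ`
has `ℚ`-rational CM (`WeierstrassCurve.not_hasRationalCM_holds`).  (Lang, Ch. 10 §4, Remark =
Silverman, *AT*, Thm. II.2.2(a); the argument of
`WeierstrassCurve.exists_sq_eq_intCast_quadraticTwist_of_hasCM`, for a given `ψ`.)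
[cite: Lang1987, Ch. 10 §4, Remark] -/
theorem exists_quadraticTwist_of_sq_eq_intCast (W : WeierstrassCurve ℚ) [W.IsElliptic]
    {ψ : AddMonoid.End W.geomPoints} (hψR : ψ ∈ W.geomEndRing) {D : ℤ} (hD : D < 0)
    (hψψ : ψ * ψ = (D : AddMonoid.End W.geomPoints)) :
    ∃ χ : absoluteGaloisGroup ℚ →* ℤˣ, (∃ σ : absoluteGaloisGroup ℚ, χ σ ≠ 1) ∧
      ∀ (σ : absoluteGaloisGroup ℚ) (P : W.geomPoints),
        ψ (σ • P) = ((χ σ : ℤˣ) : ℤ) • σ • ψ P := by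
  haveI := isDomain_geomEndRing W
  haveI := charZero_geomEndRing W
  -- the Galois group acting through ring endomorphisms `c σ`; the conjugate is `c σ * ψ * c σ⁻¹`
  set c : absoluteGaloisGroup ℚ →* AddMonoid.End W.geomPoints :=
    DistribMulAction.toAddMonoidEnd (absoluteGaloisGroup ℚ) W.geomPoints with hc
  have hconjP : ∀ (σ : absoluteGaloisGroup ℚ) (P : W.geomPoints),
      (c σ * ψ * c σ⁻¹) P = σ • ψ (σ⁻¹ • P) := fun σ P ↦ rfl
  -- the element `y = ψ` of the domain `R = End_{ℚ̄}(E)`; `y ≠ 0`, `2ψ ≠ 0`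
  set y : W.geomEndRing := ⟨ψ, hψR⟩ with hy
  have hyy : y * y = (D : W.geomEndRing) := Subtype.ext (by push_cast; exact hψψ)
  have hy0 : y ≠ 0 := by
    intro h0
    rw [h0, mul_zero] at hyy
    have : (D : W.geomEndRing) = 0 := hyy.symm
    rw [Int.cast_eq_zero] at this
    omega
  have h2ψ : ∃ P : W.geomPoints, ψ P + ψ P ≠ 0 := by
    by_contra hall
    push Not at hall
    apply hy0
    have h2 : (2 : W.geomEndRing) * y = 0 := by
      apply Subtype.ext
      change ((2 : AddMonoid.End W.geomPoints) * ψ) = 0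
      ext P
      change (2 : AddMonoid.End W.geomPoints) (ψ P) = 0
      rw [AddMonoid.End.ofNat_apply, two_nsmul]
      exact hall P
    exact (mul_eq_zero.mp h2).resolve_left two_ne_zero
  -- Step 1: every conjugate `σψσ⁻¹` is `ψ` or `-ψ`
  have hconj : ∀ σ : absoluteGaloisGroup ℚ, c σ * ψ * c σ⁻¹ = ψ ∨ c σ * ψ * c σ⁻¹ = -ψ := by
    intro σ
    have hmem : c σ * ψ * c σ⁻¹ ∈ W.geomEndRing := conj_mem_geomEndRing W hψR σ
    have hsq : (c σ * ψ * c σ⁻¹) * (c σ * ψ * c σ⁻¹) = (D : AddMonoid.End W.geomPoints) := by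
      calc (c σ * ψ * c σ⁻¹) * (c σ * ψ * c σ⁻¹)
          = c σ * ψ * (c σ⁻¹ * c σ) * ψ * c σ⁻¹ := by simp only [mul_assoc]
        _ = c σ * (ψ * ψ) * c σ⁻¹ := by
            rw [← map_mul, inv_mul_cancel, map_one, mul_one, mul_assoc (c σ)]
        _ = (D : AddMonoid.End W.geomPoints) * (c σ * c σ⁻¹) := by
            rw [hψψ, ((Int.cast_commute D (c σ)).symm).eq, mul_assoc]
        _ = (D : AddMonoid.End W.geomPoints) := by
            rw [← map_mul, mul_inv_cancel, map_one, mul_one]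
    set x : W.geomEndRing := ⟨c σ * ψ * c σ⁻¹, hmem⟩ with hx
    have hxx : x * x = (D : W.geomEndRing) := Subtype.ext (by push_cast; exact hsq)
    have hcomm : x * y = y * x := Subtype.ext (W.geomEndRing_comm_holds _ _ x.2 y.2)
    have hprod : (x - y) * (x + y) = 0 := by
      rw [sub_mul, mul_add, mul_add, hcomm, hxx, hyy]; abel
    rcases mul_eq_zero.mp hprod with h0 | h0
    · exact Or.inl (congrArg Subtype.val (sub_eq_zero.mp h0))
    · exact Or.inr (congrArg Subtype.val (eq_neg_of_add_eq_zero_left h0))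
  -- Step 2: pointwise, `σ • ψ (σ⁻¹ • P) = u • ψ P` for a unit `u = ±1`, and `u` is unique
  have hex : ∀ σ : absoluteGaloisGroup ℚ, ∃ u : ℤˣ, ∀ P : W.geomPoints,
      σ • ψ (σ⁻¹ • P) = (u : ℤ) • ψ P := by
    intro σ
    rcases hconj σ with h1 | h1
    · exact ⟨1, fun P ↦ by rw [← hconjP, h1, Units.val_one, one_zsmul]⟩
    · exact ⟨-1, fun P ↦ by
        rw [← hconjP, h1, Units.val_neg, Units.val_one, neg_one_zsmul]; rfl⟩
  have huniq : ∀ u v : ℤˣ, (∀ P : W.geomPoints, (u : ℤ) • ψ P = (v : ℤ) • ψ P) → u = v := by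
    intro u v huv
    by_contra hne
    obtain ⟨P, hP⟩ := h2ψ
    apply hP
    have key : ψ P = -ψ P := by
      rcases Int.units_eq_one_or u with rfl | rfl <;> rcases Int.units_eq_one_or v with rfl | rfl
      · exact (hne rfl).elim
      · simpa using huv P
      · simpa [eq_neg_iff_add_eq_zero, ← two_nsmul] using (huv P).symm
      · exact (hne rfl).elim
    rw [← sub_eq_zero, sub_neg_eq_add] at key
    exact key
  choose ε hε using hex
  have hε1 : ε 1 = 1 := huniq _ _ fun P ↦ by
    rw [← hε 1 P, inv_one, one_smul, one_smul, Units.val_one, one_zsmul]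
  have hεmul : ∀ σ τ, ε (σ * τ) = ε σ * ε τ := fun σ τ ↦ huniq _ _ fun P ↦ by
    rw [← hε (σ * τ) P, mul_inv_rev, mul_smul, mul_smul, hε τ (σ⁻¹ • P), smul_comm σ,
      hε σ P, smul_smul, mul_comm, Units.val_mul]
  let χ : absoluteGaloisGroup ℚ →* ℤˣ := { toFun := ε, map_one' := hε1, map_mul' := hεmul }
  have hχ : ∀ σ, χ σ = ε σ := fun σ ↦ rfl
  -- Step 3: the twisting relation `ψ (σ • P) = χ σ • σ • ψ P`
  have hrel : ∀ (σ : absoluteGaloisGroup ℚ) (P : W.geomPoints),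
      ψ (σ • P) = ((χ σ : ℤˣ) : ℤ) • σ • ψ P := fun σ P ↦ by
    have h1 := hε σ (σ • P)
    rw [inv_smul_smul] at h1
    rw [hχ, h1, smul_smul, ← Units.val_mul, Int.units_mul_self, Units.val_one, one_zsmul]
  -- Step 4: `χ ≠ 1`, for otherwise `ψ` would be a `ℚ`-rational complex multiplication
  have hne : ∃ σ : absoluteGaloisGroup ℚ, χ σ ≠ 1 := by
    by_contra hall
    push Not at hall
    have hequiv : ψ ∈ W.equivariantSubring := fun σ P ↦ by
      rw [hrel σ P, hall σ, Units.val_one, one_zsmul]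
    refine not_hasRationalCM_holds W ⟨ψ, ⟨hψR, hequiv⟩, fun n hn ↦ ?_⟩
    have hDn : (D : W.geomEndRing) = (n * n : ℤ) := by
      rw [← hyy]
      apply Subtype.ext
      push_cast
      change ψ * ψ = _
      rw [hn]
    have hDn' : D = n * n := by exact_mod_cast hDn
    nlinarith [mul_self_nonneg n]
  exact ⟨χ, hne, hrel⟩

end Literature.NumberTheory.EllipticCurves

end
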